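import Mathlib.Analysis.Fourier.Inversion
import Mathlib.Analysis.Fourier.FourierTransformDeriv
import Literature.Analysis.FunctionSpaces.PlancherelL1L2
import Literature.Analysis.FunctionSpaces.L2TemperedDistribution
import HarnessLib

/-!
# `H^s` through the weighted Fourier transform; the Sobolev lemma `H^s ⊂ C^k` (`s > k + d/2`)

Analysis/FunctionSpaces support file (third of the chain discharging
`Literature.Analysis.FluidPDE.tsai1998_profile_smooth`, Tsai 1998, p. 33).

For `f ∈ L¹ ∩ L²` on a finite-dimensional real inner product space `E` (dimension `d`), the
distribution `T_f = fnTD f` (`L2TemperedDistribution`) lies in Mathlib's Bessel-potential class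
`MemSobolev s 2` iff the classical Fourier integral satisfies `⟨ξ⟩^s 𝓕f ∈ L²`,
`⟨ξ⟩ = (1 + ‖ξ‖²)^{1/2}` (Folland, *Introduction to PDE*, 2nd ed., §6.A, Proposition (6.1)/(6.4):
`‖f‖_s = ‖Λ^s f‖_{L²}`, `(Λ^s f)^ = ⟨ξ⟩^s f̂`):

* `memLp_besselWeight_mul_fourier_of_memSobolev` (⇒) and
  `memSobolev_fnTD_of_memLp_besselWeight_mul_fourier` (⇐) — no Plancherel is needed: the Fourier
  transform of `T_f` tested on a Schwartz `ψ` is `∫ ψ 𝓕f` by self-adjointness of the Fourier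
  integral (`fourier_fnTD_apply`), and two locally integrable functions with the same Schwartz
  pairings agree a.e.;
* `integrable_pow_mul_norm_of_memLp_besselWeight` — `⟨ξ⟩^s F ∈ L²` and `d < 2(s - n)` give
  `‖ξ‖ⁿ F ∈ L¹` (Cauchy–Schwarz with `∫ ⟨ξ⟩^{2(n-s)} dξ < ∞`, the computation in the proof of
  Folland's Sobolev lemma (6.5));
* `contDiff_of_memSobolev_fnTD` — **the Sobolev lemma** (Folland, Theorem (6.5): "If
  `s > k + n/2`, then `H_s ⊂ C^k`"), in the form used by the bootstrap: a continuous compactly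
  supported `f` with `T_f ∈ H^s`, `d < 2(s - k)`, is `C^k` (Fourier inversion and Mathlib's
  `Real.contDiff_fourier`);
* bookkeeping for the product law (`SobolevBesselProductLaw`): `enorm_besselWeight_mul`,
  `lintegral_enorm_sq_lt_top_of_memLp_two`, `memLp_two_of_enorm_sq_lintegral_lt_top`,
  `integrable_fourier_of_memLp_besselWeight` (`s > d/2 ⇒ 𝓕f ∈ L¹`, the case `k = 0`),
  `fourier_fourier_eq` (`𝓕𝓕f = f(-·)`).

## References

* G. B. Folland, *Introduction to Partial Differential Equations*, 2nd ed. (1995), §6.A,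
  (6.1), (6.4), Theorem (6.5) (the Sobolev lemma) and its proof. [Folland1995PDE]
-/

noncomputable section

open MeasureTheory TemperedDistribution
open scoped ENNReal FourierTransform LineDeriv Laplacian Real SchwartzMap ContDiff

namespace Literature.Analysis.FunctionSpaces

variable {E : Type*} [NormedAddCommGroup E] [InnerProductSpace ℝ E] [FiniteDimensional ℝ E]
  [MeasurableSpace E] [BorelSpace E]

/-! ### Sobolev regularity of `T_f` read off from the weighted Fourier transform -/

omit [FiniteDimensional ℝ E] [MeasurableSpace E] [BorelSpace E] in
/-- The complexified Bessel weight `⟨ξ⟩^s = (1 + ‖ξ‖²)^{s/2}` has temperate growth (Mathlib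
`fun_prop`), so that it is an admissible multiplier on `𝓢'`. [folklore] -/
theorem hasTemperateGrowth_besselWeight (s : ℝ) :
    (fun x : E => (((1 + ‖x‖ ^ 2) ^ (s / 2) : ℝ) : ℂ)).HasTemperateGrowth := by
  fun_prop

/-- The Fourier transform of `T_f`, `f ∈ L¹ ∩ L²`, tested against a Schwartz function `ψ` is
`∫ ψ 𝓕f` (self-adjointness of the Fourier integral, the tree's
`integral_fourier_schwartz_smul_eq`). [folklore] -/
theorem fourier_fnTD_apply {f : E → ℂ} (hf1 : Integrable f) (hf2 : MemLp f 2 (volume : Measure E))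
    (ψ : 𝓢(E, ℂ)) : 𝓕 (fnTD f) ψ = ∫ ξ, ψ ξ * 𝓕 f ξ := by
  rw [TemperedDistribution.fourier_apply, fnTD_apply hf2]
  have h := integral_fourier_schwartz_smul_eq ψ hf1
  simp only [smul_eq_mul] at h
  rw [← h]
  rfl

/-- **`T_f ∈ H^s ⇒ ⟨ξ⟩^s 𝓕f ∈ L²`** for `f ∈ L¹ ∩ L²` (Folland, *Introduction to PDE*, (6.4):
`(Λ^s f)^ = ⟨ξ⟩^s f̂`; the `L²` representative of `J^s T_f` on the Fourier side agrees a.e. with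
the continuous function `⟨ξ⟩^s 𝓕f`, both having the same Schwartz pairings).
[cite: Folland1995PDE, §6.A (6.4)] -/
theorem memLp_besselWeight_mul_fourier_of_memSobolev {f : E → ℂ} (hf1 : Integrable f)
    (hf2 : MemLp f 2 (volume : Measure E)) {s : ℝ} (hs : MemSobolev s 2 (fnTD f)) :
    MemLp (fun ξ => (((1 + ‖ξ‖ ^ 2) ^ (s / 2) : ℝ) : ℂ) * 𝓕 f ξ) 2 (volume : Measure E) := by
  obtain ⟨f', hf'⟩ := memSobolev_iff_exists_smulLeftCLM_fourier.mp hs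
  set g : E → ℂ := fun ξ => (((1 + ‖ξ‖ ^ 2) ^ (s / 2) : ℝ) : ℂ) * 𝓕 f ξ with hgdef
  have hgc : Continuous g :=
    (hasTemperateGrowth_besselWeight (E := E) s).1.continuous.mul (continuous_fourierIntegral hf1)
  -- `g = f'` almost everywhere
  have hae : g =ᵐ[volume] (f' : E → ℂ) := by
    have hloc : LocallyIntegrable (g - (f' : E → ℂ)) volume :=
      hgc.locallyIntegrable.sub ((Lp.memLp f').locallyIntegrable (by norm_num))
    have h0 := ae_eq_zero_of_integral_contDiff_smul_eq_zero hloc ?_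
    · filter_upwards [h0] with x hx
      simpa [sub_eq_zero] using hx
    intro φr hφr hφrs
    have hφc : ContDiff ℝ ∞ (fun x => (φr x : ℂ)) := Complex.ofRealCLM.contDiff.comp hφr
    have hφcs : HasCompactSupport (fun x => (φr x : ℂ)) := hφrs.comp_left Complex.ofReal_zero
    set φ : 𝓢(E, ℂ) := hφcs.toSchwartzMap hφc with hφdef
    have hφ : ∀ x, φ x = (φr x : ℂ) := fun x => rfl
    have h1 : (TemperedDistribution.smulLeftCLM ℂ
        (fun x : E => (((1 + ‖x‖ ^ 2) ^ (s / 2) : ℝ) : ℂ)) (𝓕 (fnTD f))) φ = ∫ x, φ x * g x := by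
      rw [TemperedDistribution.smulLeftCLM_apply_apply, fourier_fnTD_apply hf1 hf2]
      refine integral_congr_ae (Filter.Eventually.of_forall fun x => ?_)
      simp only [SchwartzMap.smulLeftCLM_apply_apply (hasTemperateGrowth_besselWeight s),
        smul_eq_mul, hgdef]
      ring
    have h2 : (MeasureTheory.Lp.toTemperedDistribution f') φ = ∫ x, φ x * (f' : E → ℂ) x := by
      rw [MeasureTheory.Lp.toTemperedDistribution_apply]
      rfl
    have h12 : ∫ x, φ x * g x = ∫ x, φ x * (f' : E → ℂ) x := by rw [← h1, ← h2, hf']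
    have hi1 : Integrable (fun x => φ x * g x) :=
      (φ.continuous.mul hgc).integrable_of_hasCompactSupport
        ((show HasCompactSupport (φ : E → ℂ) from hφcs).mul_right)
    have hi2 : Integrable (fun x => φ x * (f' : E → ℂ) x) := integrable_schwartz_mul (Lp.memLp f') φ
    calc ∫ x, φr x • (g - (f' : E → ℂ)) x = ∫ x, (φ x * g x - φ x * (f' : E → ℂ) x) := by
          refine integral_congr_ae (Filter.Eventually.of_forall fun x => ?_)
          simp only [Pi.sub_apply, hφ, Complex.real_smul]
          ring
      _ = 0 := by rw [integral_sub hi1 hi2, h12, sub_self]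
  exact (Lp.memLp f').ae_eq hae.symm

/-- **`⟨ξ⟩^s 𝓕f ∈ L² ⇒ T_f ∈ H^s`** for `f ∈ L¹ ∩ L²` (Folland, *Introduction to PDE*, (6.4)).
[cite: Folland1995PDE, §6.A (6.4)] -/
theorem memSobolev_fnTD_of_memLp_besselWeight_mul_fourier {f : E → ℂ} (hf1 : Integrable f)
    (hf2 : MemLp f 2 (volume : Measure E)) {s : ℝ}
    (hw : MemLp (fun ξ => (((1 + ‖ξ‖ ^ 2) ^ (s / 2) : ℝ) : ℂ) * 𝓕 f ξ) 2 (volume : Measure E)) :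
    MemSobolev s 2 (fnTD f) := by
  rw [memSobolev_iff_exists_smulLeftCLM_fourier]
  refine ⟨hw.toLp _, ?_⟩
  ext φ
  rw [TemperedDistribution.smulLeftCLM_apply_apply, fourier_fnTD_apply hf1 hf2,
    MeasureTheory.Lp.toTemperedDistribution_apply]
  refine integral_congr_ae ?_
  filter_upwards [hw.coeFn_toLp] with x hx
  rw [hx, SchwartzMap.smulLeftCLM_apply_apply (hasTemperateGrowth_besselWeight s), smul_eq_mul,
    smul_eq_mul]
  ring

/-! ### Sobolev embedding `H^s ⊂ C^k` for `s > k + d/2` -/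

/-- Weighted `L²` control gives polynomially weighted `L¹` control below the critical exponent:
`⟨ξ⟩^s F ∈ L²` and `d < 2(s - n)` imply `‖ξ‖ⁿ ‖F ξ‖ ∈ L¹` — the Cauchy–Schwarz step
`∫ ⟨ξ⟩ⁿ|F| ≤ (∫ ⟨ξ⟩^{2s}|F|²)^{1/2} (∫ ⟨ξ⟩^{2(n-s)})^{1/2}` of the proof of the Sobolev lemma
(Folland, *Introduction to PDE*, proof of Theorem (6.5); `∫ (1+|ξ|²)^{n-s} dξ < ∞` is Mathlib's
`integrable_rpow_neg_one_add_norm_sq`). [cite: Folland1995PDE, §6.A Theorem (6.5) (proof)] -/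
theorem integrable_pow_mul_norm_of_memLp_besselWeight {F : E → ℂ}
    (hFm : AEStronglyMeasurable F (volume : Measure E)) {s : ℝ} {n : ℕ}
    (hns : (Module.finrank ℝ E : ℝ) < 2 * (s - n))
    (hw : MemLp (fun ξ => (((1 + ‖ξ‖ ^ 2) ^ (s / 2) : ℝ) : ℂ) * F ξ) 2 (volume : Measure E)) :
    Integrable (fun ξ => ‖ξ‖ ^ n * ‖F ξ‖) (volume : Measure E) := by
  set a : E → ℝ := fun ξ => (1 + ‖ξ‖ ^ 2) ^ (((n : ℝ) - s) / 2) with hadef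
  set b : E → ℝ := fun ξ => ‖(((1 + ‖ξ‖ ^ 2) ^ (s / 2) : ℝ) : ℂ) * F ξ‖ with hbdef
  have hac : Continuous a := by
    refine Continuous.rpow_const (by fun_prop) fun ξ => Or.inl ?_
    positivity
  have ha2 : MemLp a 2 (volume : Measure E) := by
    rw [memLp_two_iff_integrable_sq hac.aestronglyMeasurable]
    have hi := integrable_rpow_neg_one_add_norm_sq (E := E) (μ := volume) hns
    refine hi.congr (Filter.Eventually.of_forall fun ξ => ?_)
    simp only [hadef]
    rw [← Real.rpow_mul_natCast (by positivity : (0 : ℝ) ≤ 1 + ‖ξ‖ ^ 2)]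
    congr 1
    push_cast
    ring
  have hb2 : MemLp b 2 (volume : Measure E) := hw.norm
  have hab : Integrable (fun ξ => a ξ * b ξ) (volume : Measure E) := ha2.integrable_mul hb2
  refine hab.mono' ?_ (Filter.Eventually.of_forall fun ξ => ?_)
  · exact (continuous_norm.pow n).aestronglyMeasurable.mul hFm.norm
  · have h0 : 0 < 1 + ‖ξ‖ ^ 2 := by positivity
    have hpow : ‖ξ‖ ^ n ≤ (1 + ‖ξ‖ ^ 2) ^ ((n : ℝ) / 2) := by
      calc ‖ξ‖ ^ n = (‖ξ‖ ^ 2) ^ ((n : ℝ) / 2) := by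
            rw [← Real.rpow_natCast, ← Real.rpow_natCast, ← Real.rpow_mul (norm_nonneg _)]
            congr 1
            push_cast
            ring
        _ ≤ (1 + ‖ξ‖ ^ 2) ^ ((n : ℝ) / 2) :=
            Real.rpow_le_rpow (by positivity) (by linarith [sq_nonneg ‖ξ‖]) (by positivity)
    have hw' : a ξ * (1 + ‖ξ‖ ^ 2) ^ (s / 2) = (1 + ‖ξ‖ ^ 2) ^ ((n : ℝ) / 2) := by
      simp only [hadef]
      rw [← Real.rpow_add h0]
      congr 1
      ring
    rw [Real.norm_eq_abs, abs_of_nonneg (by positivity)]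
    calc ‖ξ‖ ^ n * ‖F ξ‖ ≤ (1 + ‖ξ‖ ^ 2) ^ ((n : ℝ) / 2) * ‖F ξ‖ := by gcongr
      _ = a ξ * b ξ := by
          simp only [hbdef, norm_mul, Complex.norm_real, Real.norm_eq_abs,
            abs_of_nonneg (Real.rpow_nonneg h0.le _)]
          rw [← hw']
          ring

/-- **The Sobolev lemma `H^s ⊂ C^k` for `s > k + d/2`** (Folland, *Introduction to PDE*,
Theorem (6.5): "If `s > k + ½n`, then `H_s ⊂ C^k`"), in the form consumed by the bootstrap: a
continuous compactly supported `f : E → ℂ` whose distribution is in `H^s` with `d < 2(s - k)` is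
`C^k`. Proof as in Folland: `‖ξ‖ⁿ 𝓕f ∈ L¹` for `n ≤ k`, so `𝓕(𝓕f)` is `C^k`
(`Real.contDiff_fourier`), and `f = 𝓕⁻𝓕f = (𝓕𝓕f)(-·)` by Fourier inversion.
[cite: Folland1995PDE, §6.A Theorem (6.5)] -/
theorem contDiff_of_memSobolev_fnTD {f : E → ℂ} (hfc : Continuous f) (hfs : HasCompactSupport f)
    {k : ℕ} {s : ℝ} (hks : (Module.finrank ℝ E : ℝ) < 2 * (s - k))
    (hs : MemSobolev s 2 (fnTD f)) : ContDiff ℝ k f := by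
  have hf1 : Integrable f := hfc.integrable_of_hasCompactSupport hfs
  have hf2 : MemLp f 2 (volume : Measure E) := hfc.memLp_of_hasCompactSupport hfs
  have hw := memLp_besselWeight_mul_fourier_of_memSobolev hf1 hf2 hs
  have hFm : AEStronglyMeasurable (𝓕 f) (volume : Measure E) :=
    (continuous_fourierIntegral hf1).aestronglyMeasurable
  have hint : ∀ n : ℕ, (n : ℕ∞) ≤ (k : ℕ∞) →
      Integrable (fun ξ => ‖ξ‖ ^ n * ‖𝓕 f ξ‖) (volume : Measure E) := by
    intro n hn
    have hn' : (n : ℝ) ≤ k := by exact_mod_cast (by exact_mod_cast hn : n ≤ k)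
    exact integrable_pow_mul_norm_of_memLp_besselWeight hFm (by linarith) hw
  have hF1 : Integrable (𝓕 f) (volume : Measure E) := by
    have h0 := hint 0 (by exact_mod_cast Nat.zero_le k)
    simp only [pow_zero, one_mul] at h0
    exact (integrable_norm_iff hFm).mp h0
  have hcd : ContDiff ℝ k (𝓕 (𝓕 f)) := by
    have := Real.contDiff_fourier (N := (k : ℕ∞)) hint
    exact_mod_cast this
  have hinv : f = fun x => 𝓕 (𝓕 f) (-x) := by
    have h := hfc.fourierInv_fourier_eq hf1 hF1
    funext x
    rw [← Real.fourierInv_eq_fourier_neg, h]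
  rw [hinv]
  exact hcd.comp contDiff_neg

/-! ### Bookkeeping for the product law -/

/-- `∫⁻ ‖h‖ₑ² < ∞` for `h ∈ L²` (`ℕ`-power form of the finiteness of the `L²` seminorm).
[folklore] -/
theorem lintegral_enorm_sq_lt_top_of_memLp_two {h : E → ℂ} (hh : MemLp h 2 (volume : Measure E)) :
    ∫⁻ a, ‖h a‖ₑ ^ 2 < ⊤ := by
  have := lintegral_rpow_enorm_lt_top_of_eLpNorm_lt_top two_ne_zero ENNReal.ofNat_ne_top hh.2
  simpa [ENNReal.toReal_ofNat] using this

/-- Conversely, an a.e.-strongly measurable `h` with `∫⁻ ‖h‖ₑ² < ∞` is in `L²`. [folklore] -/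
theorem memLp_two_of_enorm_sq_lintegral_lt_top {h : E → ℂ}
    (hm : AEStronglyMeasurable h (volume : Measure E)) (hh : ∫⁻ a, ‖h a‖ₑ ^ 2 < ⊤) :
    MemLp h 2 (volume : Measure E) := by
  refine ⟨hm, (eLpNorm_lt_top_iff_lintegral_rpow_enorm_lt_top two_ne_zero
    ENNReal.ofNat_ne_top).mpr ?_⟩
  simpa [ENNReal.toReal_ofNat] using hh

omit [InnerProductSpace ℝ E] [FiniteDimensional ℝ E] [MeasurableSpace E] [BorelSpace E] in
/-- `‖⟨ξ⟩^s z‖ₑ = ⟨ξ⟩^s ‖z‖ₑ` (the weight is nonnegative). [folklore] -/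
theorem enorm_besselWeight_mul (s : ℝ) (ξ : E) (z : ℂ) :
    ‖(((1 + ‖ξ‖ ^ 2) ^ (s / 2) : ℝ) : ℂ) * z‖ₑ =
      ENNReal.ofReal ((1 + ‖ξ‖ ^ 2) ^ (s / 2)) * ‖z‖ₑ := by
  rw [← ofReal_norm, ← ofReal_norm, norm_mul, Complex.norm_real,
    Real.norm_eq_abs, abs_of_nonneg (by positivity), ENNReal.ofReal_mul (by positivity)]

/-- The Fourier transform of an `L¹` function with `⟨ξ⟩^s 𝓕f ∈ L²`, `2s > d`, is integrable
(the case `k = 0` of the Sobolev lemma, Folland (6.5)). [cite: Folland1995PDE, §6.A Theorem (6.5) (proof)] -/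
theorem integrable_fourier_of_memLp_besselWeight {f : E → ℂ} (hf1 : Integrable f) {s : ℝ}
    (hsd : (Module.finrank ℝ E : ℝ) < 2 * s)
    (hw : MemLp (fun ξ => (((1 + ‖ξ‖ ^ 2) ^ (s / 2) : ℝ) : ℂ) * 𝓕 f ξ) 2 (volume : Measure E)) :
    Integrable (𝓕 f) (volume : Measure E) := by
  have hFm : AEStronglyMeasurable (𝓕 f) (volume : Measure E) :=
    (continuous_fourierIntegral hf1).aestronglyMeasurable
  have h0 := integrable_pow_mul_norm_of_memLp_besselWeight (n := 0) hFm (by simpa using hsd) hw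
  simp only [pow_zero, one_mul] at h0
  exact (integrable_norm_iff hFm).mp h0

/-- `𝓕𝓕f = f(-·)` for a continuous integrable `f` with integrable Fourier transform (Fourier
inversion, Mathlib's `Continuous.fourierInv_fourier_eq`, and `𝓕⁻F(x) = 𝓕F(-x)`). [folklore] -/
theorem fourier_fourier_eq {f : E → ℂ} (hfc : Continuous f) (hf1 : Integrable f)
    (hF1 : Integrable (𝓕 f)) (ξ : E) : 𝓕 (𝓕 f) ξ = f (-ξ) := by
  have h := hfc.fourierInv_fourier_eq hf1 hF1
  have h' := congrFun h (-ξ)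
  rwa [Real.fourierInv_eq_fourier_neg, neg_neg] at h'

end Literature.Analysis.FunctionSpaces
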